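import Summits.AtomisticToContinuum.HydrodynamicLimit.Theses.TwoClocks
import Summits.AtomisticToContinuum.HydrodynamicLimit.Theorems.OneFlightGossipEngineClampedCurrentsDockTransferTails
import Summits.AtomisticToContinuum.HydrodynamicLimit.Theorems.TransferActivityTails.Negative.EquilibriumReduction
import HarnessLib

/-!
# `TransferActivityTails` (stmt-AtomisticToContinuum-16624) — BIRTH skeleton (BC3 certificate), line `birth`

Crux `Summit.AtomisticToContinuum.HydrodynamicLimit.Theses.TwoClocks.TransferActivityTails` (route TwoClocks,
crux #7, rev 10): the a-priori `L¹` tail bound, under the TRUE pre-shock evolution from local Gibbs data,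
`∀ t < T ∃V₀ ∀V ≥ V₀ ∀ε ∃τ₀ ∀τ ≥ τ₀ ∃N₀ ∀N ≥ N₀ ∀s ≤ t: E_λ[(N+1)⁻¹ Σ_i a_i 𝟙{a_i > V}] ≤ ε` for the window
TRANSFER activity `a_i(s) = (σ/τ) Σ_{collisions of i in (s, s+w]} (‖v_i⁺ − v_i⁻‖ + |‖v_i⁺‖² − ‖v_i⁻‖²|/2)`,
`w = τ (N+1)^{-1/3}` (momentum impulse + energy impulse).

## The registered decomposition (two stubs, by ROW of the clamp the crux prices)

The transfer activity is the SUM of two nonnegative activities with physically distinct failure modes, and the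
crux is EQUIVALENT to the conjunction of their tail statements (disprover, `Disproof.lean` §1–§2 / landed
`Theorems.TransferActivityTailsNegative`: `tailsOf_of_le` gives crux ⇒ each row; the landed converse
`Theorems.ClampedCurrentsDockTransferTails.stub_transferActivityTails` gives rows ⇒ crux):

* `stub_momentumActivityTails : MomentumActivityTails` — the MOMENTUM-impulse row
  `a_i^m = (σ/τ) Σ ‖v_i⁺ − v_i⁻‖`: byte-identical (`Iff.rfl`, `momentumActivityTails_iff_oneFlight`) with the LIVE
  shared item stmt-AtomisticToContinuum-13734 `OneFlightGossipEngine.CollisionActivityTails` (this route's crux 7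
  before rev 10; route OneFlightGossipEngine's clamp-pricing crux, with its own crux chain).  Content: the true
  pre-shock law develops no long-lived CAGING / overpressured droplets of a positive fraction (momentum
  hyperactivity at bounded energy).  Why it might fail: no extensive a-priori bound on collision impulses of a
  non-equilibrium hard-sphere law is known (Serre 2021 Thm 1.1 / Serre 2024 grow in `N`); co-moving dense
  droplets have Gibbs cost per active sphere independent of `τ`, so the `s > 0` half is not priceable by entropy
  (13734 census (N2)).  Size: open-problem (= 13734).
* `stub_energyActivityTails : EnergyActivityTails` — the ENERGY-impulse row
  `a_i^e = (σ/τ) Σ |‖v_i⁺‖² − ‖v_i⁻‖²|/2 = (σ/τ) Σ ‖Δv_i‖·|⟪(v_i+v_j)/2, n̂⟫|` (momentum impulse × normal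
  centre-of-mass speed, `Disproof.lean` §4 `ofConfig_energy_jump`): byte-identical (`Iff.rfl`,
  `energyActivityTails_iff_twin`) with the registered twin `Theorems.ClampedCurrentsDockTransferTails.CollisionEnergyActivityTails`
  (input CEAT of OneFlightGossipEngine's dock stmt-14680).  Content: no cubic ENERGY-impulse tail in mean —
  no Newton-cradle-type energy RELAYS / mesoscopic energy focusing at `O(1)` probability before the first
  shock.  Why it might fail: the energy impulse is a cubic velocity functional of SUB-extensive large-deviation
  cost (HighMomentumCutoffBarrierNarrow), invisible to the `o(N)`/`O(N)` entropy bound; the row does NOT reduce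
  to the momentum row by kinematics (the c.o.m.-speed factor is unbounded; ideator-2 notes, Disproof §3(d)).
  Size: open-problem.
* `transferActivityTails_of_rows : MomentumActivityTails → EnergyActivityTails → LineTarget` (`LineTarget` :=
  the crux, an `abbrev` alias so that exactly ONE theorem of this file concludes the crux by name) — PROVED, no
  sorry, axioms {propext, Classical.choice, Quot.sound}: the landed 90-line seam `stub_transferActivityTails`
  (`σ₀ := min`, `V₀ := 2 max (V₀ᵐ, V₀ᵉ)`, both rows at level `V/2` and accuracy `ε/4`, `τ₀, N₀ := max`; pointwise
  `(p+q)𝟙{p+q>V} ≤ 2p𝟙{p>V/2} + 2q𝟙{q>V/2}`; the activities split on the good set, of full local-Gibbs measure;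
  `lintegral` additivity through the a.e.-measurability of the momentum activity via the label-aware
  collision-sum engine), transported along three `Iff.rfl`s.  This IS the BC3 composition
  `<stub₁-sig> → <stub₂-sig> → crux` (the stub signatures are these two Props verbatim).
* `TransferActivityTails_of : TwoClocks.TransferActivityTails := transferActivityTails_of_rows stub₁ stub₂` — the
  crux BY NAME from the two registered stubs (the shape `ledger skeleton check` audits: conclusion = the route
  decl, no hypotheses, every `sorry` inside a declared `stub_*`; `closed = false` until both stubs are proved).

Neither stub is cheaply the crux or the summit: momentum tails say nothing about energy relays at small
momentum activity (the 13733 Newton-cradle family has momentum activity `2σ/t → 0` and transfer activity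
`≍ σ t² → ∞`), energy tails say nothing about equal-speed cages (head-on exchanges at equal speeds carry zero
energy impulse and momentum impulse `2‖v‖`); BC3 probes `stub → crux`, `stub → _root_.HydrodynamicLimit` by
`first | exact? | simpa [S] | (unfold S; simpa) | aesop` FAIL for both stubs (planner folder `bc/*_probe*.lean`).
Both stubs are CONSEQUENCES of the crux (`momentumActivityTails_of_crux`, `energyActivityTails_of_crux` below,
from the landed Negative file), so neither can be refuted without refuting the crux.

## Disproof used (`Cruxes/TransferActivityTails/Disproof.lean` v3, disprover FINAL 2026-08-17: NO KILL)

* `_false_without_<H>` theorems: NONE exist for this crux (§6 Targets: none) — nothing to honour stub-wise; the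
  load-bearing hypotheses `V₀ > 0` and `τ → ∞` (§5, `tailsOf_of_noThreshold`, `tailsOf_of_allWindows`) are kept
  VERBATIM in both stubs (same quantifier frame as the crux).
* Landed Negative lemmas checked: `TransferActivityTailsNegative.transferActivityTailsExpMoment_false`
  (`Negative/ExpMomentLattice.lean` + `Negative/ExpMomentFalse.lean`) refutes the EXTENSIVE EXPONENTIAL-MOMENT
  strengthening — neither stub is an exponential moment (both are `L¹` tails, the crux's own currency, and both
  are implied by the crux); `Negative/EquilibriumReduction.lean` (imported here) is the source of the converses.
* Dead lines honoured: `Lines/IdeatorOneSketch-dead.md` (single stub `WeightedCountActivityTails ≥ crux`; inputs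
  (D) MarginalDomination / (E) DominatedPruning unprinted) and `Lines/Sketch-dead.md` (no concluding skeleton; MGF
  currency) — this birth skeleton registers NO dynamical mechanism; it records the crux's certified two-row
  structure and docks row 1 on the live item 13734 (leads c3–c5: "HOLD behind stmt-13734; re-line as the port
  of a closed 13734 line"), row 2 being the energy port any such line must add.

`lean check`: rc 0; sorries = 2 = stubs (`stub_momentumActivityTails`, `stub_energyActivityTails`), zero elsewhere
(`TransferActivityTails_of` reaches `sorryAx` only THROUGH the two stubs; `transferActivityTails_of_rows` not at all).
-/

noncomputable section

namespace Summit.AtomisticToContinuum.HydrodynamicLimit.Cruxes.TransferActivityTails.Birth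

open MeasureTheory Set
open scoped ENNReal BigOperators
open Summit.AtomisticToContinuum.HydrodynamicLimit.Theorems

/-! ## §1 The two row statements (verbatim copies of the tree decls they are `Iff.rfl` with) -/

/-- **Row 1 — momentum-activity tails** (= stmt-AtomisticToContinuum-13734
`Summit.AtomisticToContinuum.HydrodynamicLimit.Theses.OneFlightGossipEngine.CollisionActivityTails`, verbatim). -/
def MomentumActivityTails : Prop :=
  ∀ (a₀ θ₀ : Literature.MathematicalPhysics.KineticTheory.T3 → ℝ) (u₀ : Literature.MathematicalPhysics.KineticTheory.T3 → Literature.MathematicalPhysics.KineticTheory.V3), Continuous a₀ → Continuous θ₀ → Continuous u₀ → (∀ x, 0 < a₀ x) → (∀ x, 0 < θ₀ x) → ∃ σ₀ : ℝ, 0 < σ₀ ∧ ∀ σ : ℝ, 0 < σ → σ < σ₀ → ∀ (T : ℝ) (ρ θ : ℝ → Literature.MathematicalPhysics.KineticTheory.T3 → ℝ) (u : ℝ → Literature.MathematicalPhysics.KineticTheory.T3 → Literature.MathematicalPhysics.KineticTheory.V3), Literature.MathematicalPhysics.KineticTheory.IsHardSphereEulerSolution σ T ρ u θ → ∀ Φ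 : (N : ℕ) → Literature.Analysis.FluidPDE.HardSphereFlow (Literature.Analysis.FluidPDE.Torus.geometry (Fin 3)) (Literature.MathematicalPhysics.KineticTheory.hsDiameter σ N) (N + 1), Literature.MathematicalPhysics.KineticTheory.TendstoHydroFieldsAt (fun N => Literature.MathematicalPhysics.KineticTheory.localGibbsLaw σ a₀ u₀ θ₀ N (Φ N)) Φ ρ u θ 0 → ∀ t ∈ Set.Ico 0 T, ∃ V₀ : ℝ, 0 < V₀ ∧ ∀ V : ℝ, V₀ ≤ V → ∀ ε : ℝ, 0 < ε → ∃ τ₀ : ℝ, 0 < τ₀ ∧ ∀ τ : ℝ, τ₀ ≤ τ → ∃ N₀ : ℕ, ∀ N : ℕ, N₀ ≤ N → ∀ s ∈ Set.Icc 0 t, (let w : ℝ := τ * ((N : ℝ) + 1) ^ (-(1 / 3 : ℝ)); let P := Literature.MathematicalPhysics.KineticTheory.localGibbsLaw σ a₀ u₀ θ₀ N (Φ N); let act := fun (i : Fin (N + 1)) (z : Literature.Analysis.FluidPDE.Config (N + 1) (Fin 3) Literature.MathematicalPhysics.KineticTheory.T3) => σ / τ * (Φ N).collisionSum (Set.Ioc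 s (s + w)) (fun c => if c.fst = i then ‖c.postVel.1 - c.preVel.1‖ else 0) z; ∫⁻ z, ENNReal.ofReal (((N : ℝ) + 1)⁻¹ * ∑ i : Fin (N + 1), Set.indicator {y : ℝ | V < y} (fun y => y) (act i z)) ∂P ≤ ENNReal.ofReal ε)

/-- **Row 2 — energy-activity tails** (= the registered twin
`Summit.AtomisticToContinuum.HydrodynamicLimit.Theorems.ClampedCurrentsDockTransferTails.CollisionEnergyActivityTails`, verbatim). -/
def EnergyActivityTails : Prop :=
  ∀ (a₀ θ₀ : Literature.MathematicalPhysics.KineticTheory.T3 → ℝ) (u₀ : Literature.MathematicalPhysics.KineticTheory.T3 → Literature.MathematicalPhysics.KineticTheory.V3), Continuous a₀ → Continuous θ₀ → Continuous u₀ → (∀ x, 0 < a₀ x) → (∀ x, 0 < θ₀ x) → ∃ σ₀ : ℝ, 0 < σ₀ ∧ ∀ σ : ℝ, 0 < σ → σ < σ₀ → ∀ (T : ℝ) (ρ θ : ℝ → Literature.MathematicalPhysics.KineticTheory.T3 → ℝ) (u : ℝ → Literature.MathematicalPhysics.KineticTheory.T3 → Literature.MathematicalPhysics.KineticTheory.V3),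 Literature.MathematicalPhysics.KineticTheory.IsHardSphereEulerSolution σ T ρ u θ → ∀ Φ : (N : ℕ) → Literature.Analysis.FluidPDE.HardSphereFlow (Literature.Analysis.FluidPDE.Torus.geometry (Fin 3)) (Literature.MathematicalPhysics.KineticTheory.hsDiameter σ N) (N + 1), Literature.MathematicalPhysics.KineticTheory.TendstoHydroFieldsAt (fun N => Literature.MathematicalPhysics.KineticTheory.localGibbsLaw σ a₀ u₀ θ₀ N (Φ N)) Φ ρ u θ 0 → ∀ t ∈ Set.Ico 0 T, ∃ V₀ : ℝ, 0 < V₀ ∧ ∀ V : ℝ, V₀ ≤ V → ∀ ε : ℝ, 0 < ε → ∃ τ₀ : ℝ, 0 < τ₀ ∧ ∀ τ : ℝ, τ₀ ≤ τ → ∃ N₀ : ℕ, ∀ N : ℕ, N₀ ≤ N → ∀ s ∈ Set.Icc 0 t, (let w : ℝ := τ * ((N : ℝ) + 1) ^ (-(1 / 3 : ℝ)); let P := Literature.MathematicalPhysics.KineticTheory.localGibbsLaw σ a₀ u₀ θ₀ N (Φ N); let act := fun (i : Fin (N + 1)) (z : Literature.Analysis.FluidPDE.Config (N + 1) (Fin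 3) Literature.MathematicalPhysics.KineticTheory.T3) => σ / τ * (Φ N).collisionSum (Set.Ioc s (s + w)) (fun c => if c.fst = i then |‖c.postVel.1‖ ^ 2 - ‖c.preVel.1‖ ^ 2| / 2 else 0) z; ∫⁻ z, ENNReal.ofReal (((N : ℝ) + 1)⁻¹ * ∑ i : Fin (N + 1), Set.indicator {y : ℝ | V < y} (fun y => y) (act i z)) ∂P ≤ ENNReal.ofReal ε)

/-- Row 1 IS the live item stmt-13734 (definitionally). -/
theorem momentumActivityTails_iff_oneFlight :
    MomentumActivityTails ↔
      Summit.AtomisticToContinuum.HydrodynamicLimit.Theses.OneFlightGossipEngine.CollisionActivityTails :=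
  Iff.rfl

/-- Row 2 IS the registered twin of the dock file (definitionally). -/
theorem energyActivityTails_iff_twin :
    EnergyActivityTails ↔ ClampedCurrentsDockTransferTails.CollisionEnergyActivityTails :=
  Iff.rfl

/-- The crux IS the dock file's conclusion statement (definitionally). -/
theorem crux_iff_dock :
    Summit.AtomisticToContinuum.HydrodynamicLimit.Theses.TwoClocks.TransferActivityTails ↔
      ClampedCurrentsDockTransferTails.TransferActivityTails :=
  Iff.rfl

/-- Row 1 IS the disprover's `TailsOf momentumOf` (definitionally). -/
theorem momentumActivityTails_iff_negative :
    MomentumActivityTails ↔ TransferActivityTailsNegative.MomentumActivityTails :=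
  Iff.rfl

/-- Row 2 IS the disprover's `TailsOf energyOf` (definitionally). -/
theorem energyActivityTails_iff_negative :
    EnergyActivityTails ↔ TransferActivityTailsNegative.EnergyActivityTails :=
  Iff.rfl

/-! ## §2 The registered stubs (the ONLY sorries of this file) -/

/-- **STUB 1 (row 1, momentum impulse; the statement `MomentumActivityTails` verbatim = stmt-13734, shared with route
OneFlightGossipEngine).** -/
theorem stub_momentumActivityTails :
  ∀ (a₀ θ₀ : Literature.MathematicalPhysics.KineticTheory.T3 → ℝ) (u₀ : Literature.MathematicalPhysics.KineticTheory.T3 → Literature.MathematicalPhysics.KineticTheory.V3), Continuous a₀ → Continuous θ₀ → Continuous u₀ → (∀ x, 0 < a₀ x) → (∀ x, 0 < θ₀ x) → ∃ σ₀ : ℝ, 0 < σ₀ ∧ ∀ σ : ℝ, 0 < σ → σ < σ₀ → ∀ (T : ℝ) (ρ θ : ℝ → Literature.MathematicalPhysics.KineticTheory.T3 → ℝ) (u : ℝ → Literature.MathematicalPhysics.KineticTheory.T3 → Literature.MathematicalPhysics.KineticTheory.V3), Literature.MathematicalPhysics.KineticTheory.IsHardSphereEulerSolution σ T ρ u θ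 → ∀ Φ : (N : ℕ) → Literature.Analysis.FluidPDE.HardSphereFlow (Literature.Analysis.FluidPDE.Torus.geometry (Fin 3)) (Literature.MathematicalPhysics.KineticTheory.hsDiameter σ N) (N + 1), Literature.MathematicalPhysics.KineticTheory.TendstoHydroFieldsAt (fun N => Literature.MathematicalPhysics.KineticTheory.localGibbsLaw σ a₀ u₀ θ₀ N (Φ N)) Φ ρ u θ 0 → ∀ t ∈ Set.Ico 0 T, ∃ V₀ : ℝ, 0 < V₀ ∧ ∀ V : ℝ, V₀ ≤ V → ∀ ε : ℝ, 0 < ε → ∃ τ₀ : ℝ, 0 < τ₀ ∧ ∀ τ : ℝ, τ₀ ≤ τ → ∃ N₀ : ℕ, ∀ N : ℕ, N₀ ≤ N → ∀ s ∈ Set.Icc 0 t, (let w : ℝ := τ * ((N : ℝ) + 1) ^ (-(1 / 3 : ℝ)); let P := Literature.MathematicalPhysics.KineticTheory.localGibbsLaw σ a₀ u₀ θ₀ N (Φ N); let act := fun (i : Fin (N + 1)) (z : Literature.Analysis.FluidPDE.Config (N + 1) (Fin 3) Literature.MathematicalPhysics.KineticTheory.T3) => σ / τ * (Φ N).collisionSum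 (Set.Ioc s (s + w)) (fun c => if c.fst = i then ‖c.postVel.1 - c.preVel.1‖ else 0) z; ∫⁻ z, ENNReal.ofReal (((N : ℝ) + 1)⁻¹ * ∑ i : Fin (N + 1), Set.indicator {y : ℝ | V < y} (fun y => y) (act i z)) ∂P ≤ ENNReal.ofReal ε) := by
  sorry

/-- **STUB 2 (row 2, energy impulse; the statement `EnergyActivityTails` verbatim = the twin
`ClampedCurrentsDockTransferTails.CollisionEnergyActivityTails`).** -/
theorem stub_energyActivityTails :
  ∀ (a₀ θ₀ : Literature.MathematicalPhysics.KineticTheory.T3 → ℝ) (u₀ : Literature.MathematicalPhysics.KineticTheory.T3 → Literature.MathematicalPhysics.KineticTheory.V3), Continuous a₀ → Continuous θ₀ → Continuous u₀ → (∀ x, 0 < a₀ x) → (∀ x, 0 < θ₀ x) → ∃ σ₀ : ℝ, 0 < σ₀ ∧ ∀ σ : ℝ, 0 < σ → σ < σ₀ → ∀ (T : ℝ) (ρ θ : ℝ → Literature.MathematicalPhysics.KineticTheory.T3 → ℝ) (u : ℝ → Literature.MathematicalPhysics.KineticTheory.T3 → Literature.MathematicalPhysics.KineticTheory.V3), Literature.MathematicalPhysics.KineticTheory.IsHardSphereEulerSolution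 σ T ρ u θ → ∀ Φ : (N : ℕ) → Literature.Analysis.FluidPDE.HardSphereFlow (Literature.Analysis.FluidPDE.Torus.geometry (Fin 3)) (Literature.MathematicalPhysics.KineticTheory.hsDiameter σ N) (N + 1), Literature.MathematicalPhysics.KineticTheory.TendstoHydroFieldsAt (fun N => Literature.MathematicalPhysics.KineticTheory.localGibbsLaw σ a₀ u₀ θ₀ N (Φ N)) Φ ρ u θ 0 → ∀ t ∈ Set.Ico 0 T, ∃ V₀ : ℝ, 0 < V₀ ∧ ∀ V : ℝ, V₀ ≤ V → ∀ ε : ℝ, 0 < ε → ∃ τ₀ : ℝ, 0 < τ₀ ∧ ∀ τ : ℝ, τ₀ ≤ τ → ∃ N₀ : ℕ, ∀ N : ℕ, N₀ ≤ N → ∀ s ∈ Set.Icc 0 t, (let w : ℝ := τ * ((N : ℝ) + 1) ^ (-(1 / 3 : ℝ)); let P := Literature.MathematicalPhysics.KineticTheory.localGibbsLaw σ a₀ u₀ θ₀ N (Φ N); let act := fun (i : Fin (N + 1)) (z : Literature.Analysis.FluidPDE.Config (N + 1) (Fin 3) Literature.MathematicalPhysics.KineticTheory.T3) => σ / τ *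 (Φ N).collisionSum (Set.Ioc s (s + w)) (fun c => if c.fst = i then |‖c.postVel.1‖ ^ 2 - ‖c.preVel.1‖ ^ 2| / 2 else 0) z; ∫⁻ z, ENNReal.ofReal (((N : ℝ) + 1)⁻¹ * ∑ i : Fin (N + 1), Set.indicator {y : ℝ | V < y} (fun y => y) (act i z)) ∂P ≤ ENNReal.ofReal ε) := by
  sorry

/-! ## §3 The composition — the crux from the two row statements (sorry-free), then the crux BY NAME -/

/-- The crux decl under a local name, so that the conditional composition `transferActivityTails_of_rows` is not
itself read as "the" skeleton theorem (the skeleton audit takes the theorem concluding the crux BY NAME; exactly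
one, `TransferActivityTails_of`, does). -/
abbrev LineTarget : Prop := Summit.AtomisticToContinuum.HydrodynamicLimit.Theses.TwoClocks.TransferActivityTails

/-- **The crux from its two rows** (BC3 composition `<stub₁-sig> → <stub₂-sig> → crux`, PROVED): the landed seam
`ClampedCurrentsDockTransferTails.stub_transferActivityTails` (level `V/2`, accuracy `ε/4`, thresholds by
`min`/`max`, pointwise splitting inequality, a.e. splitting on the good set, a.e.-measurability of the momentum
activity), transported along the three `Iff.rfl`s of §1. -/
theorem transferActivityTails_of_rows : MomentumActivityTails → EnergyActivityTails → LineTarget :=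
  fun hm he =>
    crux_iff_dock.2
      (ClampedCurrentsDockTransferTails.stub_transferActivityTails (momentumActivityTails_iff_oneFlight.1 hm)
        (energyActivityTails_iff_twin.1 he))

/-- **The crux BY NAME from the two registered stubs** (the only theorem of this file whose stated conclusion is
the route decl; it reaches `sorryAx` only through `stub_momentumActivityTails` and `stub_energyActivityTails`). -/
theorem TransferActivityTails_of :
    Summit.AtomisticToContinuum.HydrodynamicLimit.Theses.TwoClocks.TransferActivityTails :=
  transferActivityTails_of_rows stub_momentumActivityTails stub_energyActivityTails

/-! ## §4 Converses (landed Negative knowledge): each stub is a CONSEQUENCE of the crux -/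

/-- The crux implies row 1 (domination `momentumOf ≤ transferOf`, landed). -/
theorem momentumActivityTails_of_crux
    (h : Summit.AtomisticToContinuum.HydrodynamicLimit.Theses.TwoClocks.TransferActivityTails) :
    MomentumActivityTails :=
  momentumActivityTails_iff_negative.2 (TransferActivityTailsNegative.momentumActivityTails_of_crux h)

/-- The crux implies row 2 (domination `energyOf ≤ transferOf`, landed). -/
theorem energyActivityTails_of_crux
    (h : Summit.AtomisticToContinuum.HydrodynamicLimit.Theses.TwoClocks.TransferActivityTails) :
    EnergyActivityTails :=
  energyActivityTails_iff_negative.2 (TransferActivityTailsNegative.energyActivityTails_of_crux h)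

/-- Hence the registered decomposition is EXACT: crux ↔ row 1 ∧ row 2. -/
theorem crux_iff_rows :
    Summit.AtomisticToContinuum.HydrodynamicLimit.Theses.TwoClocks.TransferActivityTails ↔
      (MomentumActivityTails ∧ EnergyActivityTails) :=
  ⟨fun h => ⟨momentumActivityTails_of_crux h, energyActivityTails_of_crux h⟩,
    fun h => transferActivityTails_of_rows h.1 h.2⟩

end Summit.AtomisticToContinuum.HydrodynamicLimit.Cruxes.TransferActivityTails.Birth

end
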